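import Summits.QuantumFields.YangMills.Theses.FradkinShenkerFlow
import Summits.QuantumFields.YangMills.Theorems.FradkinShenkerFlowSusceptibilityToPoincareOrbitEfronStein
import Literature.MathematicalPhysics.QuantumFieldTheory.LatticeGaugeProofs

/-!
# `ElitzurLinkCovariance` — the link coordinates of the Wilson measure are uncorrelated

Route `FradkinShenkerFlow` of `YangMills`, support item `stmt-QuantumFields-9445`
(`Summit.QuantumFields.YangMills.Theses.FradkinShenkerFlow.ElitzurLinkCovariance`, the `s = 0` end
of the localisation window). For every compact group `G` with a lattice representation `r`
(`ρ = r.ρ : G →* M_N(ℂ)`, continuous, unitary), every real `β`, every torus `(ℤ/(2S+1))⁴` with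
`S ≥ 1` and every family of matrices `h_ℓ ∈ M_N(ℂ)` indexed by the links,

  `Var_μ (Σ_ℓ Re tr(h_ℓ ρ(U_ℓ))) ≤ N Σ_ℓ ‖h_ℓ‖_F²`,  `μ = wilsonMeasure r.ρ β`:

the covariance operator of the link coordinates is bounded by `N`, uniformly in `S` and `β`.

## Proof (Elitzur-type gauge averaging)

* **Decorrelation of distinct links.** For `ℓ ≠ ℓ'` on a torus of odd side `2S+1 ≥ 3` some endpoint
  `v` of `ℓ` is not an endpoint of `ℓ'`, and `ℓ` is not a loop (`free_endpoint`: equal endpoint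
  sets would force `eᵢ = 0`, `eᵢ = eⱼ` with `i ≠ j`, or `eᵢ + eⱼ = 0`, impossible as `1 ≠ 0` and
  `2 ≠ 0` in `ℤ/(2S+1)`). The gauge rotation by `k ∈ G` at the single site `v` fixes `U_{ℓ'}` and
  maps `U_ℓ ↦ k U_ℓ` (tail) or `U_ℓ ↦ U_ℓ k⁻¹` (head); by right invariance of the Haar probability
  measure (compact groups are unimodular) the Haar average of `k ↦ Re tr(h ρ(k U_ℓ))`, resp.
  `Re tr(h ρ(U_ℓ k⁻¹))`, is a constant `c` independent of `U`. Gauge invariance of `μ`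
  (`wilsonMeasure_map_gaugeTransform_holds`, through
  `SusceptibilityToPoincare.integral_comp_gaugeTransform_wilsonMeasure`) and Fubini then give
  `E[X_ℓ Y] = c E[Y]` for every bounded measurable `Y` invariant under the rotations at `v`
  (`integral_mul_eq_const_mul_integral`), in particular `E[X_ℓ] = c` and
  `Cov(X_ℓ, X_{ℓ'}) = 0` (`covariance_eq_zero_of_orbit_const`). This works for every (possibly
  reducible) `ρ`.
* **Diagonal terms.** `Var X_ℓ ≤ E[X_ℓ²] ≤ N ‖h_ℓ‖_F²`, since `(Re tr(h M))² ≤ ‖h‖_F² ‖M‖_F²`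
  (Cauchy–Schwarz) and `‖M‖_F² = N` for unitary `M` (`trace_mul_re_sq_le`).
* `Var(Σ X_ℓ) = Σ_ℓ Σ_ℓ' Cov(X_ℓ, X_ℓ')` (Mathlib `variance_fun_sum`) finishes the proof.

Second countability of `G` (needed for the joint measurability of the gauge action in the Fubini
step) comes from the faithful representation `r`, as in the sibling files of this route.

Sources: S. Elitzur, Phys. Rev. D 12 (1975) 3978 (local gauge-variant observables average out);
K. Wilson, Phys. Rev. D 10 (1974) 2445 §III.B (gauge invariance of the lattice measure);
E. Seiler, LNP 159 (1982) §1.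
-/

noncomputable section

open MeasureTheory ProbabilityTheory
open Literature.MathematicalPhysics.QuantumFieldTheory

namespace Summit.QuantumFields.YangMills.Theorems

namespace ElitzurLinkCovariance

/-! ### Linear algebra: `(Re tr(h M))² ≤ N ‖h‖_F²` for unitary `M` -/

section LinAlg

variable {N : ℕ}

/-- Columns of a unitary matrix have unit norm: `Σ_k ‖V_{k i}‖² = 1`. [folklore] -/
theorem sum_norm_sq_col_eq_one {V : Matrix (Fin N) (Fin N) ℂ}
    (hV : V ∈ Matrix.unitaryGroup (Fin N) ℂ) (i : Fin N) : ∑ k, ‖V k i‖ ^ 2 = 1 := by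
  have h := congrArg (fun M : Matrix (Fin N) (Fin N) ℂ => M i i) (Unitary.star_mul_self_of_mem hV)
  simp only [Matrix.mul_apply, Matrix.one_apply_eq] at h
  have hk : ∀ k, (star V) i k * V k i = ((‖V k i‖ ^ 2 : ℝ) : ℂ) := by
    intro k
    rw [Matrix.star_eq_conjTranspose, Matrix.conjTranspose_apply, Complex.star_def, mul_comm,
      Complex.mul_conj, Complex.normSq_eq_norm_sq]
  simp only [hk] at h
  rw [← Complex.ofReal_sum] at h
  exact_mod_cast h

/-- **Cauchy–Schwarz for the link coordinate**: `(Re tr(h M))² ≤ N · Σ_{i,j} ‖h_{ij}‖²` for every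
`h ∈ M_N(ℂ)` and every unitary `M` (`|tr(h M)| ≤ ‖h‖_F ‖M‖_F` and `‖M‖_F² = tr(M⋆M) = N`).
[folklore] -/
theorem trace_mul_re_sq_le (h : Matrix (Fin N) (Fin N) ℂ) {M : Matrix (Fin N) (Fin N) ℂ}
    (hM : M ∈ Matrix.unitaryGroup (Fin N) ℂ) :
    ((h * M).trace.re) ^ 2 ≤ (N : ℝ) * ∑ i, ∑ j, ‖h i j‖ ^ 2 := by
  have h1 : |(h * M).trace.re| ≤ ∑ i, ∑ j, ‖h i j‖ * ‖M j i‖ := by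
    calc |(h * M).trace.re| ≤ ‖(h * M).trace‖ := Complex.abs_re_le_norm _
      _ = ‖∑ i, ∑ j, h i j * M j i‖ := by
          simp only [Matrix.trace, Matrix.diag_apply, Matrix.mul_apply]
      _ ≤ ∑ i, ‖∑ j, h i j * M j i‖ := norm_sum_le _ _
      _ ≤ ∑ i, ∑ j, ‖h i j‖ * ‖M j i‖ := Finset.sum_le_sum fun i _ =>
          (norm_sum_le _ _).trans (le_of_eq (Finset.sum_congr rfl fun j _ => norm_mul _ _))
  have h2 : (∑ i, ∑ j, ‖h i j‖ * ‖M j i‖) ^ 2 ≤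
      (∑ i, ∑ j, ‖h i j‖ ^ 2) * ∑ i, ∑ j, ‖M j i‖ ^ 2 := by
    have := Finset.sum_mul_sq_le_sq_mul_sq (Finset.univ : Finset (Fin N × Fin N))
      (fun p => ‖h p.1 p.2‖) (fun p => ‖M p.2 p.1‖)
    simpa only [Fintype.sum_prod_type] using this
  have h3 : ∑ i, ∑ j, ‖M j i‖ ^ 2 = (N : ℝ) := by
    simp only [sum_norm_sq_col_eq_one hM, Finset.sum_const, Finset.card_univ, Fintype.card_fin,
      nsmul_eq_mul, mul_one]
  calc ((h * M).trace.re) ^ 2 = |(h * M).trace.re| ^ 2 := (sq_abs _).symm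
    _ ≤ (∑ i, ∑ j, ‖h i j‖ * ‖M j i‖) ^ 2 := pow_le_pow_left₀ (abs_nonneg _) h1 2
    _ ≤ (∑ i, ∑ j, ‖h i j‖ ^ 2) * (N : ℝ) := h3 ▸ h2
    _ = (N : ℝ) * ∑ i, ∑ j, ‖h i j‖ ^ 2 := mul_comm _ _

end LinAlg

/-! ### Abstract probability: decorrelation by averaging a measure-preserving symmetry -/

section Abstract

variable {Ω K : Type*} [MeasurableSpace Ω] [MeasurableSpace K]

/-- **Averaging a symmetry.** Let `(Ω, μ)` and `(K, π)` be probability spaces, `act : K → Ω → Ω`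
jointly measurable with every `act k` leaving all integrals against `μ` invariant, `F` and `Y`
bounded measurable, `Y` invariant under every `act k`, and the orbit average `∫ F(act k ω) dπ(k)`
equal to the constant `c` for every `ω`. Then `∫ F Y dμ = c ∫ Y dμ` (invariance for each `k`,
average over `k`, Fubini). [folklore] -/
theorem integral_mul_eq_const_mul_integral {μ : Measure Ω} [IsProbabilityMeasure μ]
    {π : Measure K} [IsProbabilityMeasure π] {act : K → Ω → Ω}
    (hact : Measurable fun p : K × Ω => act p.1 p.2)
    (hinv : ∀ (k : K) (f : Ω → ℝ), ∫ ω, f (act k ω) ∂μ = ∫ ω, f ω ∂μ)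
    {F Y : Ω → ℝ} (hF : Measurable F) (hY : Measurable Y) {B C : ℝ}
    (hB : ∀ ω, ‖F ω‖ ≤ B) (hC : ∀ ω, ‖Y ω‖ ≤ C)
    (hYinv : ∀ k ω, Y (act k ω) = Y ω) {c : ℝ} (hc : ∀ ω, ∫ k, F (act k ω) ∂π = c) :
    ∫ ω, F ω * Y ω ∂μ = c * ∫ ω, Y ω ∂μ := by
  have hΦ : Measurable fun ω => F ω * Y ω := hF.mul hY
  have hΦb : ∀ ω, ‖F ω * Y ω‖ ≤ B * C := fun ω => by
    rw [norm_mul]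
    exact mul_le_mul (hB ω) (hC ω) (norm_nonneg _) ((norm_nonneg _).trans (hB ω))
  have h1 : ∫ ω, ∫ k, F (act k ω) * Y (act k ω) ∂π ∂μ = ∫ ω, F ω * Y ω ∂μ :=
    SusceptibilityToPoincare.OrbitES.integral_integral_orbit_eq (π := π) hact hinv hΦ hΦb
  have h2 : (fun ω => ∫ k, F (act k ω) * Y (act k ω) ∂π) = fun ω => c * Y ω := by
    funext ω
    simp only [hYinv]
    rw [integral_mul_const, hc ω]
  rw [← h1, h2]
  exact integral_const_mul c Y

/-- **Decorrelation by averaging a symmetry.** Under the hypotheses of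
`integral_mul_eq_const_mul_integral`, `Cov_μ(F, Y) = 0`: `E[F Y] = c E[Y]` and (with `Y = 1`)
`E[F] = c`. [folklore] -/
theorem covariance_eq_zero_of_orbit_const {μ : Measure Ω} [IsProbabilityMeasure μ]
    {π : Measure K} [IsProbabilityMeasure π] {act : K → Ω → Ω}
    (hact : Measurable fun p : K × Ω => act p.1 p.2)
    (hinv : ∀ (k : K) (f : Ω → ℝ), ∫ ω, f (act k ω) ∂μ = ∫ ω, f ω ∂μ)
    {F Y : Ω → ℝ} (hF : Measurable F) (hY : Measurable Y) {B C : ℝ}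
    (hB : ∀ ω, ‖F ω‖ ≤ B) (hC : ∀ ω, ‖Y ω‖ ≤ C)
    (hYinv : ∀ k ω, Y (act k ω) = Y ω) {c : ℝ} (hc : ∀ ω, ∫ k, F (act k ω) ∂π = c) :
    cov[F, Y; μ] = 0 := by
  have h1 : ∫ ω, F ω * Y ω ∂μ = c * ∫ ω, Y ω ∂μ :=
    integral_mul_eq_const_mul_integral hact hinv hF hY hB hC hYinv hc
  have h2 : ∫ ω, F ω ∂μ = c := by
    have h := integral_mul_eq_const_mul_integral (Y := fun _ => (1 : ℝ)) (C := 1) hact hinv hF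
      measurable_const hB (fun _ => by simp) (fun _ _ => rfl) hc
    simpa using h
  rw [covariance_eq_sub (MemLp.of_bound hF.aestronglyMeasurable B (ae_of_all _ hB))
    (MemLp.of_bound hY.aestronglyMeasurable C (ae_of_all _ hC))]
  have h3 : μ[F * Y] = ∫ ω, F ω * Y ω ∂μ := rfl
  rw [h3, h1, h2]
  ring

end Abstract

/-! ### The torus: single-site gauge rotations and free endpoints -/

section Lattice

variable {d L : ℕ} {G : Type*} [Group G]

/-- The gauge rotation by `k` at the single site `v` (`Function.update 1 v k`) on a link `e`:
`U_e ↦ γ(x) U_e γ(x + eᵢ)⁻¹` with `γ = k` at `v` and `1` elsewhere. [folklore] -/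
theorem gaugeTransform_update_apply [DecidableEq (Site d L)] (v : Site d L) (k : G)
    (U : GaugeConfig d L G) (e : Edge d L) :
    gaugeTransform (Function.update (1 : Site d L → G) v k) U e =
      (if e.1 = v then k else 1) * U e * (if e.1.shift e.2 = v then k else 1)⁻¹ := by
  simp only [gaugeTransform, Function.update_apply, Pi.one_apply]

/-- A rotation at `v` does not move a link none of whose endpoints is `v`. [folklore] -/
theorem gaugeTransform_update_of_ne [DecidableEq (Site d L)] {v : Site d L} (k : G)
    (U : GaugeConfig d L G) {e : Edge d L} (h1 : e.1 ≠ v) (h2 : e.1.shift e.2 ≠ v) :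
    gaugeTransform (Function.update (1 : Site d L → G) v k) U e = U e := by
  rw [gaugeTransform_update_apply, if_neg h1, if_neg h2, one_mul, inv_one, mul_one]

/-- A rotation at the tail `x` of a non-loop link `(x, i)` is left multiplication: `U_e ↦ k U_e`.
[folklore] -/
theorem gaugeTransform_update_tail [DecidableEq (Site d L)] {v : Site d L} (k : G)
    (U : GaugeConfig d L G) {e : Edge d L} (h1 : e.1 = v) (h2 : e.1.shift e.2 ≠ v) :
    gaugeTransform (Function.update (1 : Site d L → G) v k) U e = k * U e := by
  rw [gaugeTransform_update_apply, if_pos h1, if_neg h2, inv_one, mul_one]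

/-- A rotation at the head `x + eᵢ` of a non-loop link `(x, i)` is right multiplication by the
inverse: `U_e ↦ U_e k⁻¹`. [folklore] -/
theorem gaugeTransform_update_head [DecidableEq (Site d L)] {v : Site d L} (k : G)
    (U : GaugeConfig d L G) {e : Edge d L} (h1 : e.1 ≠ v) (h2 : e.1.shift e.2 = v) :
    gaugeTransform (Function.update (1 : Site d L → G) v k) U e = U e * k⁻¹ := by
  rw [gaugeTransform_update_apply, if_neg h1, if_pos h2, one_mul]

/-- **Free endpoints on a torus of odd side `2S+1 ≥ 3`.** A link `ℓ = (x, i)` is not a loop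
(`x ≠ x + eᵢ`), and for `ℓ ≠ ℓ'` either the tail `x` or the head `x + eᵢ` of `ℓ` is not an
endpoint of `ℓ'`: two distinct positively oriented links never have the same endpoint set, since
that would force `eᵢ = 0`, `eᵢ = eⱼ` with `(x, i) ≠ (x, j)`, or `eᵢ + eⱼ = 0`, all impossible because
`1 ≠ 0` and `2 ≠ 0` in `ℤ/(2S+1)`. (For side `1` every link is a loop; for side `2` opposite links
share both endpoints — the hypothesis `1 ≤ S` is needed.) [folklore] -/
theorem free_endpoint {S : ℕ} (hS : 1 ≤ S) {ℓ ℓ' : Edge d (2 * S + 1)} (hne : ℓ ≠ ℓ') :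
    ℓ.1 ≠ ℓ.1.shift ℓ.2 ∧
      ((ℓ'.1 ≠ ℓ.1 ∧ ℓ'.1.shift ℓ'.2 ≠ ℓ.1) ∨
        (ℓ'.1 ≠ ℓ.1.shift ℓ.2 ∧ ℓ'.1.shift ℓ'.2 ≠ ℓ.1.shift ℓ.2)) := by
  obtain ⟨x, i⟩ := ℓ
  obtain ⟨y, j⟩ := ℓ'
  haveI : Fact (1 < 2 * S + 1) := ⟨by omega⟩
  have h2 : (2 : ZMod (2 * S + 1)) ≠ 0 := by
    intro h
    have h' : ((2 : ℕ) : ZMod (2 * S + 1)) = 0 := by exact_mod_cast h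
    rw [ZMod.natCast_eq_zero_iff] at h'
    have := Nat.le_of_dvd two_pos h'
    omega
  have eself : ∀ (z : Site d (2 * S + 1)) (k : Fin d), z ≠ z.shift k := by
    intro z k h
    have := congrFun h k
    simp [Site.shift] at this
  simp only
  refine ⟨eself x i, ?_⟩
  by_cases hA : y ≠ x ∧ y.shift j ≠ x
  · exact Or.inl hA
  · right
    rw [not_and_or, not_ne_iff, not_ne_iff] at hA
    rcases hA with rfl | hA
    · refine ⟨eself y i, fun h => hne ?_⟩
      have hij : Pi.single (M := fun _ : Fin d => ZMod (2 * S + 1)) j 1 = Pi.single i 1 :=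
        add_left_cancel (a := y) h
      have : j = i := by
        by_contra hji
        have := congrFun hij j
        simp [Ne.symm hji] at this
      subst this
      rfl
    · subst hA
      refine ⟨fun h => ?_, eself (y.shift j) i⟩
      have := congrFun h i
      by_cases hji : j = i
      · subst hji
        simp only [Site.shift, Pi.add_apply, Pi.single_eq_same] at this
        rw [add_assoc, left_eq_add, one_add_one_eq_two] at this
        exact h2 this
      · simp [Site.shift, Ne.symm hji] at this

variable [TopologicalSpace G] [IsTopologicalGroup G] [CompactSpace G] [MeasurableSpace G]
  [BorelSpace G]

/-- `∫ f(u k⁻¹) dk = ∫ f(k⁻¹) dk` for the Haar probability measure of a compact group: substitute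
`k ↦ k u` (right invariance; compact groups are unimodular). [folklore] -/
theorem integral_haar_comp_mul_inv (f : G → ℝ) (u : G) :
    ∫ k, f (u * k⁻¹) ∂haarProbability G = ∫ k, f k⁻¹ ∂haarProbability G := by
  have h := integral_mul_right_eq_self (μ := haarProbability G) (fun k => f (u * k⁻¹)) u
  rw [← h]
  refine integral_congr_ae (ae_of_all _ fun k => ?_)
  simp only [mul_inv_rev, mul_inv_cancel_left]

variable {N : ℕ} (ρ : G →* Matrix (Fin N) (Fin N) ℂ)

/-- **Haar average of a link coordinate over the rotations at its tail** is the constant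
`∫ Re tr(h ρ(k)) dk`: the rotation acts by `U_ℓ ↦ k U_ℓ` and the Haar probability measure is right
invariant. (The constant is `Re tr(h P)` with `P = ∫ ρ dHaar` the projection onto the
`ρ`-invariants; only its independence of `U` is used.) [folklore] -/
theorem integral_link_rotate_tail [DecidableEq (Site d L)] (hm : Matrix (Fin N) (Fin N) ℂ)
    {ℓ : Edge d L} (hloop : ℓ.1 ≠ ℓ.1.shift ℓ.2) (U : GaugeConfig d L G) :
    ∫ k, ((hm * ρ (gaugeTransform (Function.update (1 : Site d L → G) ℓ.1 k) U ℓ)).trace).re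
        ∂haarProbability G = ∫ k, ((hm * ρ k).trace).re ∂haarProbability G := by
  have hk : ∀ k : G, gaugeTransform (Function.update (1 : Site d L → G) ℓ.1 k) U ℓ = k * U ℓ :=
    fun k => gaugeTransform_update_tail k U rfl hloop.symm
  simp only [hk]
  exact integral_mul_right_eq_self (μ := haarProbability G) (fun k => ((hm * ρ k).trace).re) (U ℓ)

/-- **Haar average of a link coordinate over the rotations at its head** is the constant
`∫ Re tr(h ρ(k⁻¹)) dk`: the rotation acts by `U_ℓ ↦ U_ℓ k⁻¹` (`integral_haar_comp_mul_inv`).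
[folklore] -/
theorem integral_link_rotate_head [DecidableEq (Site d L)] (hm : Matrix (Fin N) (Fin N) ℂ)
    {ℓ : Edge d L} (hloop : ℓ.1 ≠ ℓ.1.shift ℓ.2) (U : GaugeConfig d L G) :
    ∫ k, ((hm * ρ (gaugeTransform (Function.update (1 : Site d L → G) (ℓ.1.shift ℓ.2) k) U
        ℓ)).trace).re ∂haarProbability G = ∫ k, ((hm * ρ k⁻¹).trace).re ∂haarProbability G := by
  have hk : ∀ k : G,
      gaugeTransform (Function.update (1 : Site d L → G) (ℓ.1.shift ℓ.2) k) U ℓ = U ℓ * k⁻¹ :=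
    fun k => gaugeTransform_update_head k U hloop rfl
  simp only [hk]
  exact integral_haar_comp_mul_inv (fun k => ((hm * ρ k).trace).re) (U ℓ)

/-- **Elitzur decorrelation at a site.** For the Wilson measure `μ = wilsonMeasure ρ β`
(continuous `ρ`, second-countable compact `G`), a site `v`, and bounded measurable `F`, `Y` with
`Y` invariant under the gauge rotations at `v` and the Haar average of `F` over those rotations a
constant independent of the configuration: `Cov_μ(F, Y) = 0`. Gauge invariance of `μ`
(`wilsonMeasure_map_gaugeTransform_holds`) supplies the invariance, joint continuity of the gauge
action the measurability. [folklore] -/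
theorem covariance_eq_zero_of_siteRotation [NeZero L] [SecondCountableTopology G]
    [DecidableEq (Site d L)] (hρ : Continuous ρ) (β : ℝ) (v : Site d L)
    {F Y : GaugeConfig d L G → ℝ} (hF : Measurable F) (hY : Measurable Y) {B C : ℝ}
    (hB : ∀ U, ‖F U‖ ≤ B) (hC : ∀ U, ‖Y U‖ ≤ C)
    (hYinv : ∀ k U, Y (gaugeTransform (Function.update (1 : Site d L → G) v k) U) = Y U)
    {c : ℝ} (hc : ∀ U, ∫ k, F (gaugeTransform (Function.update (1 : Site d L → G) v k) U)
      ∂haarProbability G = c) :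
    cov[F, Y; wilsonMeasure (d := d) (L := L) ρ β] = 0 := by
  haveI := isProbabilityMeasure_wilsonMeasure (d := d) (L := L) ρ hρ β
  have hact : Measurable fun p : G × GaugeConfig d L G =>
      gaugeTransform (Function.update (1 : Site d L → G) v p.1) p.2 :=
    (SusceptibilityToPoincare.continuous_gaugeAction_univ (d := d) (L := L) (G := G)).measurable.comp
      (((measurable_update (1 : Site d L → G)).comp measurable_fst).prodMk measurable_snd)
  have hinv : ∀ (k : G) (f : GaugeConfig d L G → ℝ),
      ∫ U, f (gaugeTransform (Function.update (1 : Site d L → G) v k) U) ∂wilsonMeasure ρ β =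
        ∫ U, f U ∂wilsonMeasure (d := d) (L := L) ρ β := fun k f =>
    SusceptibilityToPoincare.integral_comp_gaugeTransform_wilsonMeasure ρ β _ f
  exact covariance_eq_zero_of_orbit_const (π := haarProbability G) hact hinv hF hY hB hC hYinv hc

end Lattice

end ElitzurLinkCovariance

open ElitzurLinkCovariance in
/-- **`ElitzurLinkCovariance` (item stmt-QuantumFields-9445), proved.** For every compact group `G`
with a lattice representation `r`, every real `β`, every `S ≥ 1` and every `h : links → M_N(ℂ)`,
`Var_μ(Σ_ℓ Re tr(h_ℓ ρ(U_ℓ))) ≤ N Σ_ℓ Σ_{i,j} ‖h_ℓ i j‖²` for the Wilson measure `μ` on the torus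
`(ℤ/(2S+1))⁴`: distinct link coordinates are uncorrelated (Elitzur gauge averaging at a free
endpoint, `covariance_eq_zero_of_siteRotation` with `free_endpoint`), and each diagonal term is at
most `E[X_ℓ²] ≤ N ‖h_ℓ‖_F²` (`trace_mul_re_sq_le`). [folklore] -/
theorem ElitzurLinkCovariance_proof :
    Summit.QuantumFields.YangMills.Theses.FradkinShenkerFlow.ElitzurLinkCovariance := by
  unfold Summit.QuantumFields.YangMills.Theses.FradkinShenkerFlow.ElitzurLinkCovariance
  intro G _ _ _ _ _ _ r β S hS h
  classical
  haveI : SecondCountableTopology G :=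
    (r.continuous.isClosedEmbedding r.injective).isEmbedding.secondCountableTopology
  set μ : Measure (GaugeConfig 4 (2 * S + 1) G) :=
    wilsonMeasure (d := 4) (L := 2 * S + 1) r.ρ β with hμ
  haveI : IsProbabilityMeasure μ :=
    isProbabilityMeasure_wilsonMeasure (d := 4) (L := 2 * S + 1) r.ρ r.continuous β
  -- the link coordinates
  set X : Edge 4 (2 * S + 1) → GaugeConfig 4 (2 * S + 1) G → ℝ :=
    fun ℓ U => ((h ℓ * r.ρ (U ℓ)).trace).re with hX
  have hXm : ∀ ℓ, Measurable (X ℓ) := fun ℓ =>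
    (Complex.continuous_re.comp
      ((continuous_const.mul (r.continuous.comp (continuous_apply ℓ))).matrix_trace)).measurable
  have hXb : ∀ ℓ U, (X ℓ U) ^ 2 ≤ (r.N : ℝ) * ∑ i, ∑ j, ‖h ℓ i j‖ ^ 2 := fun ℓ U =>
    trace_mul_re_sq_le (h ℓ) (r.mem_unitary (U ℓ))
  have hXn : ∀ ℓ U, ‖X ℓ U‖ ≤ Real.sqrt ((r.N : ℝ) * ∑ i, ∑ j, ‖h ℓ i j‖ ^ 2) := fun ℓ U => by
    rw [Real.norm_eq_abs]
    exact Real.abs_le_sqrt (hXb ℓ U)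
  have hXmem : ∀ ℓ, MemLp (X ℓ) 2 μ := fun ℓ =>
    MemLp.of_bound (hXm ℓ).aestronglyMeasurable _ (ae_of_all _ (hXn ℓ))
  -- decorrelation of distinct links
  have hcov : ∀ ℓ ℓ', ℓ ≠ ℓ' → cov[X ℓ, X ℓ'; μ] = 0 := by
    intro ℓ ℓ' hne
    obtain ⟨hloop, hfree⟩ := free_endpoint (d := 4) hS hne
    rcases hfree with ⟨h1, h2⟩ | ⟨h1, h2⟩
    · exact covariance_eq_zero_of_siteRotation r.ρ r.continuous β ℓ.1 (hXm ℓ) (hXm ℓ') (hXn ℓ)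
        (hXn ℓ') (fun k U => by simp only [hX, gaugeTransform_update_of_ne k U h1 h2])
        (fun U => integral_link_rotate_tail r.ρ (h ℓ) hloop U)
    · exact covariance_eq_zero_of_siteRotation r.ρ r.continuous β (ℓ.1.shift ℓ.2) (hXm ℓ)
        (hXm ℓ') (hXn ℓ) (hXn ℓ')
        (fun k U => by simp only [hX, gaugeTransform_update_of_ne k U h1 h2])
        (fun U => integral_link_rotate_head r.ρ (h ℓ) hloop U)
  -- diagonal terms
  have hdiag : ∀ ℓ, Var[X ℓ; μ] ≤ (r.N : ℝ) * ∑ i, ∑ j, ‖h ℓ i j‖ ^ 2 := fun ℓ => by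
    calc Var[X ℓ; μ] ≤ μ[X ℓ ^ 2] := variance_le_expectation_sq (hXm ℓ).aestronglyMeasurable
      _ = ∫ U, (X ℓ U) ^ 2 ∂μ := rfl
      _ ≤ ∫ _U, (r.N : ℝ) * ∑ i, ∑ j, ‖h ℓ i j‖ ^ 2 ∂μ :=
          integral_mono (hXmem ℓ).integrable_sq (integrable_const _) fun U => hXb ℓ U
      _ = (r.N : ℝ) * ∑ i, ∑ j, ‖h ℓ i j‖ ^ 2 := by simp
  -- assembly
  calc Var[fun U => ∑ ℓ, X ℓ U; μ] = ∑ ℓ, ∑ ℓ', cov[X ℓ, X ℓ'; μ] := variance_fun_sum hXmem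
    _ = ∑ ℓ, cov[X ℓ, X ℓ; μ] := Finset.sum_congr rfl fun ℓ _ =>
        Finset.sum_eq_single ℓ (fun ℓ' _ hne => hcov ℓ ℓ' (Ne.symm hne)) (by simp)
    _ = ∑ ℓ, Var[X ℓ; μ] := by simp only [covariance_self (hXm _).aemeasurable]
    _ ≤ ∑ ℓ, (r.N : ℝ) * ∑ i, ∑ j, ‖h ℓ i j‖ ^ 2 := Finset.sum_le_sum fun ℓ _ => hdiag ℓ
    _ = (r.N : ℝ) * ∑ ℓ, ∑ i, ∑ j, ‖h ℓ i j‖ ^ 2 := by rw [Finset.mul_sum]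

open ElitzurLinkCovariance SusceptibilityToPoincare in
/-- **Single-link marginals of the Wilson measure are Haar** (companion of the item, same gauge
averaging): on `(ℤ/(2S+1))^d`, `S ≥ 1`, for every link `ℓ` and bounded measurable `f : G → ℝ`,
`E_μ[f(U_ℓ)] = ∫ f dHaar` — rotate the tail of `ℓ` by `k` (gauge invariance of `μ`), average over
`k` (Fubini), use right invariance of the Haar probability measure. [folklore] -/
theorem integral_comp_link_wilsonMeasure_eq_haar {d S : ℕ} (hS : 1 ≤ S) {G : Type} [Group G]
    [TopologicalSpace G] [IsTopologicalGroup G] [CompactSpace G] [MeasurableSpace G] [BorelSpace G]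
    (r : LatticeRep G) (β : ℝ) (ℓ : Edge d (2 * S + 1)) {f : G → ℝ} (hf : Measurable f) {B : ℝ}
    (hB : ∀ k, ‖f k‖ ≤ B) :
    ∫ U, f (U ℓ) ∂wilsonMeasure (d := d) (L := 2 * S + 1) r.ρ β = ∫ k, f k ∂haarProbability G := by
  classical
  haveI := (r.continuous.isClosedEmbedding r.injective).isEmbedding.secondCountableTopology
  haveI := isProbabilityMeasure_wilsonMeasure (d := d) (L := 2 * S + 1) r.ρ r.continuous β
  haveI : Fact (1 < 2 * S + 1) := ⟨by omega⟩
  have hloop : ℓ.1.shift ℓ.2 ≠ ℓ.1 := fun h => by simpa [Site.shift] using congrFun h ℓ.2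
  have hk : ∀ (U : GaugeConfig d (2 * S + 1) G) (k : G),
      gaugeTransform (Function.update (1 : Site d (2 * S + 1) → G) ℓ.1 k) U ℓ = k * U ℓ :=
    fun U k => gaugeTransform_update_tail k U rfl hloop
  have h : ∫ U, ∫ k, f (gaugeTransform (Function.update (1 : Site d (2 * S + 1) → G) ℓ.1 k) U ℓ)
      ∂haarProbability G ∂wilsonMeasure (d := d) (L := 2 * S + 1) r.ρ β =
      ∫ U, f (U ℓ) ∂wilsonMeasure (d := d) (L := 2 * S + 1) r.ρ β :=
    OrbitES.integral_integral_orbit_eq (π := haarProbability G) (Φ := fun U => f (U ℓ))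
      ((continuous_gaugeAction_univ (G := G)).measurable.comp (((measurable_update
        (1 : Site d (2 * S + 1) → G)).comp measurable_fst).prodMk measurable_snd))
      (fun k F => integral_comp_gaugeTransform_wilsonMeasure r.ρ β _ F)
      (hf.comp (measurable_pi_apply ℓ)) fun U => hB (U ℓ)
  rw [← h]
  simp [hk, integral_mul_right_eq_self (μ := haarProbability G) f]

end Summit.QuantumFields.YangMills.Theorems

end
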